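import Literature.Computation.Sparse.SparseFinsupp
import Mathlib.Tactic.Abel
import HarnessLib

/-!
# Dense accumulation of column operators (compute bridge, sequel of `SparseFinsupp`)

Topic `Computation/Sparse`.  The list evaluation `applyCols` of `SparseFinsupp` followed by a sort is
`O(N log N)` in the number `N` of produced entries and allocates `N` list cells; certificates whose
intermediate vectors have `10⁴–10⁵` entries need the `O(N)` alternative: ACCUMULATE the scaled
columns directly into a dense array segment.  A DENSE SEGMENT is an offset `off` and an array
`a : Array ℚ`, meaning `Σ_{t < a.size} a[t] • δ_{off + t}`; the array is threaded LINEARLY through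
the accumulation (so the runtime updates it in place).  Proved here:

* `toFA_addAtA?` — adding `x` at a global index inside the segment adds `x • δ_j` to the meaning;
  `toFA_accumColA?`, **`toFA_accumA?`** — accumulating `c • col i` for `(i, c) ∈ s` adds
  `colOp K col (toF s)`; the `Option` is `none` exactly when some target index falls outside the
  segment (a checker then rejects) — no silent truncation;
* `DSeg` — the bundled form (`toFD`, `zero`, `accum?`, `accumCol?`, `nonzeros`, `allZero`) with
  `toFD_accum?`, `toFD_accumCol?`, `toF_nonzeros` (reading a segment back as a sparse list
  preserves the meaning), `toFD_zero`, `toFD_eq_zero_of_allZero` (the residual test);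
* `accumA?_congr` — the accumulation only consults the columns at indices present in `s`.

Fact-free, sorry-free.  Sources as in `SparseFinsupp`: coordinate/dense storage of sparse vectors
(Saad 2003 §3.4) and column-oriented accumulation ("gaxpy", Golub–Van Loan §1.1.8).
-/

namespace Literature.Computation.Sparse

open SpVec Finset

/-! ### Arrays as dense segments -/

section Arrays

variable (K : Type*) [Field K] [CharZero K]

/-- Meaning of the array `a` placed at offset `off`: `Σ_{t < a.size} a[t] • δ_{off+t}`.
[cite: Saad2003, §3.4 (coordinate storage format: duplicate entries are summed)] -/
noncomputable def toFA (off : ℕ) (a : Array ℚ) : ℕ →₀ K :=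
  ∑ t ∈ range a.size, Finsupp.single (off + t) ((a[t]?.getD 0 : ℚ) : K)

/-- Add `x` at GLOBAL index `j` (array threaded linearly); `none` if `j` is outside the segment.
[folklore] -/
def addAtA? (off : ℕ) (a : Array ℚ) (j : ℕ) (x : ℚ) : Option (Array ℚ) :=
  if j < off then none else
    if h : j - off < a.size then
      let y := a[j - off]
      some (a.set (j - off) (y + x))
    else none

/-- Adding `x` at `j` adds `x • δ_j` to the meaning. [cite: GolubVanLoan2013, §1.1.8 (column-oriented gaxpy: Ax as a linear combination of columns)] -/
theorem toFA_addAtA? {off : ℕ} {a a' : Array ℚ} {j : ℕ} {x : ℚ} (h : addAtA? off a j x = some a') :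
    toFA K off a' = toFA K off a + Finsupp.single j (x : K) := by
  unfold addAtA? at h
  split_ifs at h with h1 h2
  simp only [Option.some.injEq] at h
  subst h
  set i := j - off with hi
  have hj : off + i = j := by omega
  unfold toFA
  simp only [Array.size_set]
  have hmem : i ∈ range a.size := mem_range.mpr h2
  rw [← add_sum_erase _ _ hmem, ← add_sum_erase _ _ hmem]
  have hsame : ∀ t ∈ (range a.size).erase i,
      Finsupp.single (off + t) (((a.set i (a[i] + x))[t]?.getD 0 : ℚ) : K) =
        Finsupp.single (off + t) ((a[t]?.getD 0 : ℚ) : K) := by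
    intro t ht
    have hti : i ≠ t := fun h ↦ (Finset.ne_of_mem_erase ht) h.symm
    rw [Array.getElem?_set_ne h2 hti]
  rw [sum_congr rfl hsame]
  have hat : ((a.set i (a[i] + x))[i]?.getD 0 : ℚ) = a[i] + x := by
    rw [Array.getElem?_set_self]
    rfl
  have hai : (a[i]?.getD 0 : ℚ) = a[i] := by
    rw [Array.getElem?_eq_getElem h2]
    rfl
  rw [hat, hai, hj, Rat.cast_add, Finsupp.single_add]
  abel

/-- Accumulate `c •` (a list of (global index, entry) pairs) into the array. [folklore] -/
def accumColA? (off : ℕ) (c : ℚ) : SpVec → Array ℚ → Option (Array ℚ)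
  | [], a => some a
  | q :: t, a => match addAtA? off a q.1 (c * q.2) with
    | none => none
    | some a' => accumColA? off c t a'

/-- Accumulating a scaled column adds `c •` its meaning. [cite: GolubVanLoan2013, §1.1.8 (column-oriented gaxpy: Ax as a linear combination of columns)] -/
theorem toFA_accumColA? {off : ℕ} {c : ℚ} : ∀ {l : SpVec} {a a' : Array ℚ},
    accumColA? off c l a = some a' → toFA K off a' = toFA K off a + (c : K) • toF K l := by
  intro l
  induction l with
  | nil =>
    intro a a' h
    simp only [accumColA?, Option.some.injEq] at h
    subst h
    simp
  | cons q t ih =>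
    intro a a' h
    simp only [accumColA?] at h
    split at h
    · exact absurd h (by simp)
    · next a₁ ha₁ =>
      rw [ih h, toFA_addAtA? K ha₁, toF_cons, smul_add, Rat.cast_mul, ← smul_eq_mul,
        Finsupp.smul_single]
      simp only [smul_eq_mul]
      abel

/-- Accumulate `Σ_{(i,c) ∈ s} c • col i` into the array. [folklore] -/
def accumA? (col : ℕ → SpVec) (off : ℕ) : SpVec → Array ℚ → Option (Array ℚ)
  | [], a => some a
  | p :: t, a => match accumColA? off p.2 (col p.1) a with
    | none => none
    | some a' => accumA? col off t a'

/-- **The dense bridge**: a successful accumulation adds `colOp K col (toF s)` to the meaning.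
[cite: GolubVanLoan2013, §1.1.8 (column-oriented gaxpy: Ax as a linear combination of columns)] -/
theorem toFA_accumA? {col : ℕ → SpVec} {off : ℕ} : ∀ {s : SpVec} {a a' : Array ℚ},
    accumA? col off s a = some a' → toFA K off a' = toFA K off a + colOp K col (toF K s) := by
  intro s
  induction s with
  | nil =>
    intro a a' h
    simp only [accumA?, Option.some.injEq] at h
    subst h
    simp
  | cons p t ih =>
    intro a a' h
    simp only [accumA?] at h
    split at h
    · exact absurd h (by simp)
    · next a₁ ha₁ =>
      rw [ih h, toFA_accumColA? K ha₁, toF_cons, map_add, colOp_single]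
      abel

omit [CharZero K] in
/-- The accumulation consults the columns only at the indices present in `s`. [cite: GolubVanLoan2013, §1.1.8 (column-oriented gaxpy: Ax as a linear combination of columns)] -/
theorem accumA?_congr {col col' : ℕ → SpVec} {off : ℕ} :
    ∀ {s : SpVec}, (∀ p ∈ s, col p.1 = col' p.1) → ∀ (a : Array ℚ),
      accumA? col off s a = accumA? col' off s a := by
  intro s
  induction s with
  | nil => intro _ a; rfl
  | cons p t ih =>
    intro hs a
    simp only [accumA?]
    rw [hs p (by simp)]
    split
    · rfl
    · exact ih (fun q hq ↦ hs q (by simp [hq])) _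

omit [CharZero K] in
/-- The zero array means `0`. [cite: Saad2003, §3.4 (coordinate storage format: duplicate entries are summed)] -/
theorem toFA_replicate_zero (off n : ℕ) : toFA K off (Array.replicate n 0) = 0 := by
  unfold toFA
  refine Finset.sum_eq_zero fun t _ ↦ ?_
  have : ((Array.replicate n (0 : ℚ))[t]?.getD 0 : ℚ) = 0 := by
    rw [Array.getElem?_replicate]
    split <;> rfl
  rw [this, Rat.cast_zero, Finsupp.single_zero]

end Arrays

/-! ### Bundled dense segments -/

/-- A dense segment: offset and entries; meaning `Σ_{t < a.size} a[t] • δ_{off+t}` (dense storage of a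
slice of a sparse vector). [cite: Saad2003, §3.4 (coordinate storage format: duplicate entries are summed)] -/
structure DSeg where
  off : ℕ
  a : Array ℚ
  deriving Inhabited

namespace DSeg

variable (K : Type*) [Field K] [CharZero K]

/-- The meaning of a dense segment. [cite: Saad2003, §3.4 (coordinate storage format: duplicate entries are summed)] -/
noncomputable def toFD (v : DSeg) : ℕ →₀ K := toFA K v.off v.a

/-- The zero segment of a given offset and size. [folklore] -/
def zero (off n : ℕ) : DSeg := ⟨off, Array.replicate n 0⟩

omit [CharZero K] in
/-- The zero segment means `0`. [cite: Saad2003, §3.4 (coordinate storage format: duplicate entries are summed)] -/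
theorem toFD_zero (off n : ℕ) : toFD K (zero off n) = 0 := toFA_replicate_zero K off n

/-- Accumulate `Σ_{(i,c) ∈ s} c • col i` into the segment (the array is threaded linearly). [folklore] -/
def accum? (col : ℕ → SpVec) (v : DSeg) (s : SpVec) : Option DSeg :=
  match accumA? col v.off s v.a with
  | none => none
  | some a => some ⟨v.off, a⟩

/-- **The dense bridge (bundled)**. [cite: GolubVanLoan2013, §1.1.8 (column-oriented gaxpy: Ax as a linear combination of columns)] -/
theorem toFD_accum? {col : ℕ → SpVec} {v v' : DSeg} {s : SpVec} (h : accum? col v s = some v') :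
    toFD K v' = toFD K v + colOp K col (toF K s) := by
  unfold accum? at h
  split at h
  · exact absurd h (by simp)
  · next a ha =>
    simp only [Option.some.injEq] at h
    subst h
    exact toFA_accumA? K ha

/-- Accumulate `c • s` into the segment. [folklore] -/
def accumCol? (v : DSeg) (c : ℚ) (s : SpVec) : Option DSeg :=
  match accumColA? v.off c s v.a with
  | none => none
  | some a => some ⟨v.off, a⟩

/-- Meaning of `accumCol?`. [cite: GolubVanLoan2013, §1.1.8 (column-oriented gaxpy: Ax as a linear combination of columns)] -/
theorem toFD_accumCol? {v v' : DSeg} {c : ℚ} {s : SpVec} (h : accumCol? v c s = some v') :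
    toFD K v' = toFD K v + (c : K) • toF K s := by
  unfold accumCol? at h
  split at h
  · exact absurd h (by simp)
  · next a ha =>
    simp only [Option.some.injEq] at h
    subst h
    exact toFA_accumColA? K ha

/-- All entries `(off + t, a[t])` as a sparse list. [folklore] -/
def entries (v : DSeg) : SpVec := (List.range v.a.size).map fun t ↦ (v.off + t, v.a[t]?.getD 0)

omit [CharZero K] in
/-- The entry list has the segment's meaning. [cite: Saad2003, §3.4 (coordinate storage format: duplicate entries are summed)] -/
theorem toF_entries (v : DSeg) : toF K v.entries = toFD K v := by
  unfold toFD toFA entries toF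
  have hrange : (List.range v.a.size).toFinset = Finset.range v.a.size := by ext x; simp
  rw [List.map_map, ← hrange, List.sum_toFinset _ List.nodup_range]
  rfl

/-- The non-zero entries as a sparse list. [folklore] -/
def nonzeros (v : DSeg) : SpVec := v.entries.filter fun p ↦ p.2 ≠ 0

omit [CharZero K] in
/-- Reading back the non-zero entries preserves the meaning. [cite: Saad2003, §3.4 (coordinate storage format: duplicate entries are summed)] -/
theorem toF_nonzeros (v : DSeg) : toF K v.nonzeros = toFD K v := by
  rw [nonzeros, ← toF_entries K v]
  exact toF_dropZeros K v.entries

/-- The residual test: all entries are zero. [folklore] -/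
def allZero (v : DSeg) : Bool := v.a.all (· == 0)

omit [CharZero K] in
/-- A segment passing the residual test means `0`. [cite: Saad2003, §3.4 (coordinate storage format: duplicate entries are summed)] -/
theorem toFD_eq_zero_of_allZero {v : DSeg} (h : v.allZero = true) : toFD K v = 0 := by
  unfold toFD toFA
  refine Finset.sum_eq_zero fun t ht ↦ ?_
  have htl : t < v.a.size := mem_range.mp ht
  have h0 : v.a[t] = 0 := by
    rw [allZero, Array.all_eq_true] at h
    simpa using h t htl
  rw [Array.getElem?_eq_getElem htl, Option.getD_some, h0, Rat.cast_zero, Finsupp.single_zero]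

end DSeg

end Literature.Computation.Sparse
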